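import Mathlib.Analysis.InnerProductSpace.PiL2
import Mathlib.Analysis.Calculus.FDeriv.Equiv
import Mathlib.Topology.Algebra.Module.Equiv
import Mathlib.Topology.Algebra.Module.FiniteDimension
import Mathlib.Algebra.BigOperators.Group.Finset.Defs
import HarnessLib

/-!
# Stub Z2 `stub_defect_perm` for crux `MoebiusLimitExists` (stmt-CriticalPhenomena-1344), line `Sketch` v16
(THEOREM-ONLY, `--supports stmt-CriticalPhenomena-1344`)

**Permutation invariance of the pointwise special-conformal defect.**  For one level
`F : (ℝ³)ⁿ → ℝ`, a scaling dimension `Δ` and a generator `b ∈ ℝ³`, the pointwise SCT defect is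
`E_b(F)(x) := DF(x)[(‖xᵢ‖² b − 2⟪b,xᵢ⟫ xᵢ)ᵢ] − 2Δ (Σᵢ ⟪b,xᵢ⟫) F(x)`
(Lean:
`fderiv ℝ F x (fun i => ‖x i‖ ^ 2 • b - (2 * inner ℝ b (x i)) • x i) - 2 * Δ * (∑ i, inner ℝ b (x i)) * F x`).
If `F` is invariant under relabelling the points by a permutation `σ` (`F (y ∘ σ) = F y` for all `y`), then
`E_b(F)(x ∘ σ) = E_b(F)(x)`.

Proof.  Relabelling `P y := y ∘ σ` is a continuous linear equivalence of `(ℝ³)ⁿ`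
(`LinearEquiv.funCongrLeft`, made continuous by finite-dimensionality), and `F ∘ P = F`.  By
`ContinuousLinearEquiv.comp_right_fderiv` (which needs NO differentiability hypothesis: both sides vanish when `F` is
not differentiable), `fderiv ℝ F x = (fderiv ℝ F (x ∘ σ)) ∘ P`, and `P` maps the configuration field at `x`
to the configuration field at `x ∘ σ` definitionally.  The sums `Σᵢ ⟪b, x_{σ i}⟫ = Σᵢ ⟪b, xᵢ⟫` agree by
reindexing (`Equiv.sum_comp`), and `F (x ∘ σ) = F x` by hypothesis.

References: standard (relabelling symmetry commutes with the conformal generators).  No definitions are introduced.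
-/

noncomputable section

open Function

namespace Summit.CriticalPhenomena.Ising3DConformalLimit.MoebiusLimitExistsSketchV16

/-- **Chain rule for relabelling.**  If `F : (ℝ³)ⁿ → ℝ` is invariant under relabelling the points by `σ`
(`F (y ∘ σ) = F y`), then its Fréchet derivative at `x` is the derivative at `x ∘ σ` precomposed with the
relabelling: `DF(x)[v] = DF(x ∘ σ)[v ∘ σ]` for every direction `v` (no differentiability hypothesis: if `F` is not
differentiable at `x ∘ σ` it is not differentiable at `x` either and both sides are `0`). [folklore] -/
theorem fderiv_apply_of_perm_invariant (n : ℕ) (F : (Fin n → EuclideanSpace ℝ (Fin 3)) → ℝ)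
    (σ : Equiv.Perm (Fin n)) (hF : ∀ y : Fin n → EuclideanSpace ℝ (Fin 3), F (y ∘ σ) = F y)
    (x v : Fin n → EuclideanSpace ℝ (Fin 3)) :
    fderiv ℝ F x v = fderiv ℝ F (x ∘ σ) (v ∘ σ) := by
  -- the relabelling as a continuous linear equivalence `P y = y ∘ σ`
  let P : (Fin n → EuclideanSpace ℝ (Fin 3)) ≃L[ℝ] (Fin n → EuclideanSpace ℝ (Fin 3)) :=
    (LinearEquiv.funCongrLeft ℝ (EuclideanSpace ℝ (Fin 3)) σ).toContinuousLinearEquiv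
  have hFP : F ∘ P = F := funext fun y => hF y
  have hfd : fderiv ℝ (F ∘ P) x = (fderiv ℝ F (P x)).comp (P : _ →L[ℝ] _) := P.comp_right_fderiv
  rw [hFP] at hfd
  rw [hfd]
  rfl

/-- **STUB Z2 `stub_defect_perm` (S, pure analysis).**  For a level invariant under relabelling the points by a
permutation `σ` (`F (y ∘ σ) = F y`), the pointwise special-conformal defect
`E_b(F)(x) := DF(x)[(‖xᵢ‖² b − 2⟪b,xᵢ⟫ xᵢ)ᵢ] − 2Δ (Σᵢ ⟪b,xᵢ⟫) F(x)` is invariant: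
`E_b(F)(x ∘ σ) = E_b(F)(x)` (the configuration field and `Σ⟪b,xᵢ⟫` are relabelled accordingly; no
differentiability hypothesis). [folklore] -/
theorem stub_defect_perm : ∀ (n : ℕ) (F : (Fin n → EuclideanSpace ℝ (Fin 3)) → ℝ) (Δ : ℝ) (σ : Equiv.Perm (Fin n)),
    (∀ y : Fin n → EuclideanSpace ℝ (Fin 3), F (y ∘ σ) = F y) →
    ∀ (b : EuclideanSpace ℝ (Fin 3)) (x : Fin n → EuclideanSpace ℝ (Fin 3)),
    fderiv ℝ F (x ∘ σ) (fun i => ‖(x ∘ σ) i‖ ^ 2 • b - (2 * inner ℝ b ((x ∘ σ) i)) • (x ∘ σ) i) -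
        2 * Δ * (∑ i, inner ℝ b ((x ∘ σ) i)) * F (x ∘ σ) =
      fderiv ℝ F x (fun i => ‖x i‖ ^ 2 • b - (2 * inner ℝ b (x i)) • x i) - 2 * Δ * (∑ i, inner ℝ b (x i)) * F x := by
  intro n F Δ σ hF b x
  have h1 : fderiv ℝ F x (fun i => ‖x i‖ ^ 2 • b - (2 * inner ℝ b (x i)) • x i) =
      fderiv ℝ F (x ∘ σ)
        (fun i => ‖(x ∘ σ) i‖ ^ 2 • b - (2 * inner ℝ b ((x ∘ σ) i)) • (x ∘ σ) i) :=
    fderiv_apply_of_perm_invariant n F σ hF x _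
  have h2 : ∑ i, inner ℝ b ((x ∘ σ) i) = ∑ i, inner ℝ b (x i) :=
    Equiv.sum_comp σ (fun i => inner ℝ b (x i))
  rw [h1, h2, hF x]

end Summit.CriticalPhenomena.Ising3DConformalLimit.MoebiusLimitExistsSketchV16

end
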